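import Summits.AtomisticToContinuum.Crystallization.Theorems.ThreeConeCertificateSlackRigidityUniqFinal
import Summits.AtomisticToContinuum.Crystallization.Theorems.SquareWellLayerCakeTwelveWithinOneHcpCellCertificate
import Summits.AtomisticToContinuum.Crystallization.Theorems.ChargedEnergyGap.Negative.BlocksBound
import HarnessLib

/-!
# Certified admissibility of the relaxed-hcp Lennard-Jones optimum
(crux `SlackRigidity`, stmt-AtomisticToContinuum-11960, line `priced-floors-palm-exactification`, lead c22)

Every box-minimiser `(a, h) ∈ [1/2, 2]²` of the energy per particle `e(hcp(a, h))` of the relaxed hcp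
stacking (in-layer spacing `a`, layer spacing `h`; the object of item 9224 `PalmRigidity` and of the
landed `stub_hcpOptimalCongruent`) has

* shape `h/a ∈ (8148/10000, 8250/10000)` and
* spacing `a ∈ [963/1000, 976/1000]` (indeed `a ≥ 55/57 + 1/500`),

hence is ADMISSIBLE LAYERING DATA in the sense of item 13958 `NearFieldConvexity` / the line's
`IsAdmissibleLayering` (`a ∈ [47/50, 1]`, interlayer spacing `h ∈ [39a/50, 17a/20]`):
`lms_hcpBoxMinimiser_window`, `lms_hcpBoxMinimiser_admissible`, and the same for a relaxed hcp attaining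
the periodic infimum `⨅_Q e(Q)` (`lms_hcpOptimal_admissible` — the template of `PalmRigidity`).

WHY IT MATTERS FOR THE CRUX.  The live line closes the crux modulo `CoerciveTwoShellGap ∧ NearFieldConvexity`
(items 13956 ∧ 13958, p151540) and modulo the weaker one-scale residual `FiniteLayerRigidity` (p156040).
Were the optimal relaxed hcp NOT admissible, the deep interior of a large optimal-hcp block would consist
of `1/20`-good particles that are never `η`-layered for small `η`, and `NearFieldConvexity` AS TYPED would
fail with `Ω =` that interior (left side `≈ c·N`, right side `O(N^{2/3})`): the only registered stub of the
line would be false.  This file removes that failure mode by a certificate, in the crux's own vocabulary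
(box-minimisers of `(hcpPeriodicConfiguration ha hh).energyPerParticle lennardJones`), and supplies the
admissibility input of the converse `PalmRigidity → FiniteLayerRigidity`.

PROOF (no new numerics, no new definitions).  A box-minimiser has shape `c = h/a ∈ [7/10, 9/10]`
maximising `G = S₃²/S₆` on that window and `a⁶ = S₆(c)/S₃(c)` (`EkelandSurgeryParityHcpUniq.boxMinimiser_spec`
fed with the landed `stub_hcpShapeExclusion`).  A maximiser on the window is a GLOBAL maximiser on `(0, ∞)`
(`isGlobalMax_of_isMaxOn_window`: outside `(39/50, 17/20)` the certified exclusion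
`stub_relaxedReferenceExclusion` of crux 9226 bounds `G` strictly below the certified reference value
`shapeL_le ≤ G(4083/5000)`), so the landed Fermat-sign window of crux 15808
(`SquareWellLayerCakeTwelveWithinOne.shape_argmax_window'`: `F(0.8148) < 0 < F(0.8250)` for the strictly
increasing Fermat function `F = S₆D₃ − S₃D₆`) pins `c ∈ (0.8148, 0.8250)`, and the landed cells
(`cells_window`) together with one more antitone bracket of this file (`ratio_window`, from the landed grid
bounds `uqGridW_8148/8250`, `s6_lo_8250`, `s3_hi_8250` and the tree's kernel sum `uqFSW_0_3_8148_14`) bracket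
`a⁶ = S₆/S₃ ∈ [(55/57 + 1/500)⁶, (976/1000)⁶]`.  All `[folklore]`.
-/

noncomputable section

namespace Summit.AtomisticToContinuum.Crystallization.Theorems.SlackRigidityHcpAdmissible

open Set
open Literature.MathematicalPhysics.StatisticalMechanics
open Summit.AtomisticToContinuum.Crystallization.Theorems.ExcessDecayLiouvilleCoarseGrains
open Summit.AtomisticToContinuum.Crystallization.Theorems.PalmUnimodularRigidity.LayeredLawsSelectHcp
open Summit.AtomisticToContinuum.Crystallization.Theorems.EkelandSurgeryParityUniq
open Summit.AtomisticToContinuum.Crystallization.Theorems.EkelandSurgeryParityHcpUniq (boxMinimiser_spec)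
open Summit.AtomisticToContinuum.Crystallization.Theorems.SquareWellLayerCakeTwelveWithinOne
  (s6_lo_8250 s3_hi_8250 shape_argmax_window' cells_window)

/-! ## From a maximiser on the middle window to a global maximiser -/

/-- **A maximiser of `G = S₃²/S₆` on `[7/10, 9/10]` is a global maximiser on `(0, ∞)`**: outside
`(39/50, 17/20)` the certified exclusion of crux 9226 gives `G ≤ 14.457431022²/12.138038647`, strictly below
the certified reference value `14.450852575²/12.126150439 ≤ G(4083/5000)` (`shapeL_le`), and
`4083/5000 ∈ [7/10, 9/10]`. [folklore] -/
theorem isGlobalMax_of_isMaxOn_window {c : ℝ}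
    (hmax : ∀ x : ℝ, 7 / 10 ≤ x → x ≤ 9 / 10 →
      hcpSumS 3 x ^ 2 / hcpSumS 6 x ≤ hcpSumS 3 c ^ 2 / hcpSumS 6 c) :
    ∀ c' : ℝ, 0 < c' → hcpSumS 3 c' ^ 2 / hcpSumS 6 c' ≤ hcpSumS 3 c ^ 2 / hcpSumS 6 c := by
  intro c' hc'
  by_cases hin : 39 / 50 < c' ∧ c' < 17 / 20
  · exact hmax c' (by linarith [hin.1]) (by linarith [hin.2])
  · have hout : c' ≤ 39 / 50 ∨ 17 / 20 ≤ c' := by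
      rcases not_and_or.1 hin with h | h
      · exact Or.inl (not_lt.1 h)
      · exact Or.inr (not_lt.1 h)
    have hex := stub_relaxedReferenceExclusion c' hc' hout
    have hS6 : 0 < hcpSumS 6 c' := hcpSumS_pos_gen (by norm_num) hc'
    have h1 : hcpSumS 3 c' ^ 2 / hcpSumS 6 c' ≤ 14.457431022 ^ 2 / 12.138038647 := by
      rw [div_le_div_iff₀ hS6 (by norm_num)]
      linarith
    have h2 : (14.457431022 : ℝ) ^ 2 / 12.138038647 < 14.450852575 ^ 2 / 12.126150439 := by norm_num
    have h3 := shapeL_le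
    have h4 := hmax ((4083 : ℝ) / 5000) (by norm_num) (by norm_num)
    linarith

/-- **Shape window.**  Every maximiser `c ≥ 7/10` of `G = S₃²/S₆` on `[7/10, 9/10]` lies in `(8148/10000, 8250/10000)`
(global maximiser by `isGlobalMax_of_isMaxOn_window`, then the landed Fermat-sign window
`shape_argmax_window'`). [folklore] -/
theorem shapeMax_window (c : ℝ) (hc1 : 7 / 10 ≤ c)
    (hmax : ∀ x : ℝ, 7 / 10 ≤ x → x ≤ 9 / 10 →
      hcpSumS 3 x ^ 2 / hcpSumS 6 x ≤ hcpSumS 3 c ^ 2 / hcpSumS 6 c) :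
    (8148 : ℝ) / 10000 < c ∧ c < (8250 : ℝ) / 10000 :=
  shape_argmax_window' (by linarith) (isGlobalMax_of_isMaxOn_window hmax)

/-! ## One more antitone bracket of the optimal dilation on the shape window -/

/-- `S₃(0.8148) ≤ 14.531068031` (the tree's kernel sum `uqFSW_0_3_8148_14`, tail `hcpSumTail 3 14`). [folklore] -/
theorem s3_hi_8148 : hcpSumS 3 ((8148 : ℝ) / 10000) ≤ 14.531068031 :=
  le_trans (hcpSumS_le_cert_gen (e := 3) (by norm_num) (p := 8148) (q := 10000) (by norm_num) (by norm_num)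
      (θ := ((3 : ℝ) / 5)) (by norm_num) (by norm_num) (by norm_num) (K := 14) (by norm_num) (M := 10 ^ 50)
      (by norm_num))
    (by rw [uqFSW_0_3_8148_14]; unfold hcpSumTail; norm_num)

/-- **Dilation bracket on the shape window**: for `c ∈ (8148/10000, 8250/10000)`,
`(963/1000)⁶ ≤ S₆(c)/S₃(c) ≤ (976/1000)⁶` (antitone bracketing of `S₃, S₆` between the two grid points;
the upper bound `0.976` sharpens the landed `1 − 1/500` of `cells_window`). [folklore] -/
theorem ratio_window (c : ℝ) (hc1 : (8148 : ℝ) / 10000 < c) (hc2 : c < (8250 : ℝ) / 10000) :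
    ((963 : ℝ) / 1000) ^ 6 ≤ hcpSumS 6 c / hcpSumS 3 c ∧
      hcpSumS 6 c / hcpSumS 3 c ≤ ((976 : ℝ) / 1000) ^ 6 := by
  have h0 : (0 : ℝ) < (8148 : ℝ) / 10000 := by norm_num
  have hc : 0 < c := h0.trans hc1
  obtain ⟨-, -, -, -, -, hs6hi⟩ := uqGridW_8148
  obtain ⟨-, -, -, -, hs3lo', -⟩ := uqGridW_8250
  -- brackets at `c`
  have a3hi : hcpSumS 3 c ≤ 14.531068031 := (hcpSumS_antitone_gen (by norm_num) h0 hc1.le).trans s3_hi_8148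
  have a3lo : 14.158320700 ≤ hcpSumS 3 c := hs3lo'.trans (hcpSumS_antitone_gen (by norm_num) hc hc2.le)
  have a6hi : hcpSumS 6 c ≤ 12.234019459 := (hcpSumS_antitone_gen (by norm_num) h0 hc1.le).trans hs6hi
  have a6lo : 11.648030918 ≤ hcpSumS 6 c := s6_lo_8250.trans (hcpSumS_antitone_gen (by norm_num) hc hc2.le)
  have hS3 : 0 < hcpSumS 3 c := hcpSumS_pos_gen (by norm_num) hc
  constructor
  · rw [le_div_iff₀ hS3]
    have : ((963 : ℝ) / 1000) ^ 6 * 14.531068031 ≤ 11.648030918 := by norm_num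
    nlinarith
  · rw [div_le_iff₀ hS3]
    have : (12.234019459 : ℝ) ≤ ((976 : ℝ) / 1000) ^ 6 * 14.158320700 := by norm_num
    nlinarith

/-! ## Box-minimisers of the relaxed-hcp energy -/

/-- **Shape, dilation and bonds of a box-minimiser.**  Every minimiser `(a, h)` of `e(hcp(a, h))` over
`[1/2, 2]²` has `h/a ∈ (8148/10000, 8250/10000)`, `a ∈ [55/57 + 1/500, 976/1000]`, and interlayer bond
`√(a²/3 + h²)`-cubed-squared `(a²/3 + h²)³ ∈ [(55/57 + 1/500)⁶, (1 − 1/500)⁶]`. [folklore] -/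
theorem hcpBoxMinimiser_data {a h : ℝ} (ha : a ≠ 0) (hh : h ≠ 0)
    (ha1 : 1 / 2 ≤ a) (ha2 : a ≤ 2) (hh1 : 1 / 2 ≤ h) (hh2 : h ≤ 2)
    (hmin : ∀ (b k : ℝ) (hb : b ≠ 0) (hk : k ≠ 0), 1 / 2 ≤ b → b ≤ 2 → 1 / 2 ≤ k → k ≤ 2 →
      (hcpPeriodicConfiguration ha hh).energyPerParticle lennardJones ≤
        (hcpPeriodicConfiguration hb hk).energyPerParticle lennardJones) :
    ((8148 : ℝ) / 10000 < h / a ∧ h / a < (8250 : ℝ) / 10000) ∧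
      (55 / 57 + 1 / 500 ≤ a ∧ a ≤ 976 / 1000) ∧
      ((55 / 57 + 1 / 500 : ℝ) ^ 6 ≤ (a ^ 2 / 3 + h ^ 2) ^ 3 ∧
        (a ^ 2 / 3 + h ^ 2) ^ 3 ≤ (1 - 1 / 500 : ℝ) ^ 6) := by
  obtain ⟨hc1, -, hmax, ha6⟩ := boxMinimiser_spec stub_hcpShapeExclusion ha hh ha1 ha2 hh1 hh2 hmin
  obtain ⟨hw1, hw2⟩ := shapeMax_window (h / a) hc1 hmax
  obtain ⟨-, hr2⟩ := ratio_window (h / a) hw1 hw2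
  obtain ⟨k1, -, k3, k4⟩ := cells_window (h / a) hw1.le hw2.le
  have ha0 : 0 < a := by linarith
  rw [← ha6] at hr2 k1 k3 k4
  have hn6 : (6 : ℕ) ≠ 0 := by norm_num
  have halo : 55 / 57 + 1 / 500 ≤ a := (pow_le_pow_iff_left₀ (by norm_num) ha0.le hn6).1 k1
  have hahi : a ≤ 976 / 1000 := (pow_le_pow_iff_left₀ ha0.le (by norm_num) hn6).1 hr2
  have hq : a ^ 6 * (1 / 3 + (h / a) ^ 2) ^ 3 = (a ^ 2 / 3 + h ^ 2) ^ 3 := by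
    field_simp
  rw [hq] at k3 k4
  exact ⟨⟨hw1, hw2⟩, ⟨halo, hahi⟩, ⟨k3, k4⟩⟩

/-- **Window of a box-minimiser** (registered sub-goal `lms_hcpBoxMinimiser_window` of
stmt-AtomisticToContinuum-11960): every minimiser `(a, h)` of `e(hcp(a, h))` over the box `[1/2, 2]²`
has shape `h/a ∈ (8148/10000, 8250/10000)` and spacing `a ∈ [963/1000, 976/1000]`. [folklore] -/
theorem lms_hcpBoxMinimiser_window :
    ∀ (a h : ℝ) (ha : a ≠ 0) (hh : h ≠ 0), 1 / 2 ≤ a → a ≤ 2 → 1 / 2 ≤ h → h ≤ 2 →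
    (∀ (b k : ℝ) (hb : b ≠ 0) (hk : k ≠ 0), 1 / 2 ≤ b → b ≤ 2 → 1 / 2 ≤ k → k ≤ 2 →
      (hcpPeriodicConfiguration ha hh).energyPerParticle lennardJones ≤
        (hcpPeriodicConfiguration hb hk).energyPerParticle lennardJones) →
    8148 / 10000 < h / a ∧ h / a < 8250 / 10000 ∧ 963 / 1000 ≤ a ∧ a ≤ 976 / 1000 := by
  intro a h ha hh ha1 ha2 hh1 hh2 hmin
  obtain ⟨⟨hw1, hw2⟩, ⟨halo, hahi⟩, -⟩ := hcpBoxMinimiser_data ha hh ha1 ha2 hh1 hh2 hmin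
  exact ⟨by linarith [hw1], by linarith [hw2], by linarith [halo], hahi⟩

/-- **Admissibility of a box-minimiser** (registered sub-goal `lms_hcpBoxMinimiser_admissible` of
stmt-AtomisticToContinuum-11960): every minimiser `(a, h)` of `e(hcp(a, h))` over `[1/2, 2]²` is admissible
layering data in the sense of item 13958 — `a ∈ [47/50, 1]` and interlayer spacing
`h ∈ [39a/50, 17a/20]`. [folklore] -/
theorem lms_hcpBoxMinimiser_admissible :
    ∀ (a h : ℝ) (ha : a ≠ 0) (hh : h ≠ 0), 1 / 2 ≤ a → a ≤ 2 → 1 / 2 ≤ h → h ≤ 2 →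
    (∀ (b k : ℝ) (hb : b ≠ 0) (hk : k ≠ 0), 1 / 2 ≤ b → b ≤ 2 → 1 / 2 ≤ k → k ≤ 2 →
      (hcpPeriodicConfiguration ha hh).energyPerParticle lennardJones ≤
        (hcpPeriodicConfiguration hb hk).energyPerParticle lennardJones) →
    47 / 50 ≤ a ∧ a ≤ 1 ∧ 39 / 50 * a ≤ h ∧ h ≤ 17 / 20 * a := by
  intro a h ha hh ha1 ha2 hh1 hh2 hmin
  obtain ⟨hw1, hw2, halo, hahi⟩ := lms_hcpBoxMinimiser_window a h ha hh ha1 ha2 hh1 hh2 hmin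
  have ha0 : 0 < a := by linarith
  refine ⟨by linarith, by linarith, ?_, ?_⟩
  · have : (39 : ℝ) / 50 ≤ h / a := by linarith
    rw [le_div_iff₀ ha0] at this
    linarith
  · have : h / a ≤ (17 : ℝ) / 20 := by linarith
    rw [div_le_iff₀ ha0] at this
    linarith

/-- **Admissibility of an optimal relaxed hcp** (registered sub-goal `lms_hcpOptimal_admissible` of
stmt-AtomisticToContinuum-11960; the template of item 9224 `PalmRigidity` / `HcpOptimalInBox`): if
`hcp(a, h)` with `(a, h) ∈ [1/2, 2]²` attains the periodic Lennard-Jones infimum `⨅_Q e(Q)` (a genuine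
infimum: `ChargedEnergyGapNegative.bddBelow_energyPerParticle_lennardJones`, item 0714), then
`h/a ∈ (8148/10000, 8250/10000)`, `a ∈ [963/1000, 976/1000]`, and in particular `(a, h)` is admissible
layering data (`a ∈ [47/50, 1]`, `h ∈ [39a/50, 17a/20]`). [folklore] -/
theorem lms_hcpOptimal_admissible :
    ∀ (a h : ℝ) (ha : a ≠ 0) (hh : h ≠ 0), 1 / 2 ≤ a → a ≤ 2 → 1 / 2 ≤ h → h ≤ 2 →
    (hcpPeriodicConfiguration ha hh).energyPerParticle lennardJones =
      (⨅ Q : PeriodicConfiguration 3, Q.energyPerParticle lennardJones) →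
    (8148 / 10000 < h / a ∧ h / a < 8250 / 10000 ∧ 963 / 1000 ≤ a ∧ a ≤ 976 / 1000) ∧
    (47 / 50 ≤ a ∧ a ≤ 1 ∧ 39 / 50 * a ≤ h ∧ h ≤ 17 / 20 * a) := by
  intro a h ha hh ha1 ha2 hh1 hh2 hopt
  have hmin : ∀ (b k : ℝ) (hb : b ≠ 0) (hk : k ≠ 0), 1 / 2 ≤ b → b ≤ 2 → 1 / 2 ≤ k → k ≤ 2 →
      (hcpPeriodicConfiguration ha hh).energyPerParticle lennardJones ≤
        (hcpPeriodicConfiguration hb hk).energyPerParticle lennardJones := by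
    intro b k hb hk _ _ _ _
    rw [hopt]
    exact ciInf_le ChargedEnergyGapNegative.bddBelow_energyPerParticle_lennardJones _
  exact ⟨lms_hcpBoxMinimiser_window a h ha hh ha1 ha2 hh1 hh2 hmin,
    lms_hcpBoxMinimiser_admissible a h ha hh ha1 ha2 hh1 hh2 hmin⟩

end Summit.AtomisticToContinuum.Crystallization.Theorems.SlackRigidityHcpAdmissible

end
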